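import Summits.HodgeConjecture.HodgeConjecture.Theorems.HCCMUnconditionalHD3OfFacts
import Summits.HodgeConjecture.CorCM.HypD3.A4LiuD3LineRigidityS6a
import Literature.RepresentationTheory.MoeglinVignerasWaldspurger1987.RankOneThetaLiftLinesDisjointHolds
import HarnessLib

/-!
# `HCCMUnconditional.HD3` modulo the ONE remaining fact IV-4(c3) `rankOne_theta_twist_rigidity`

Topic: summit `HodgeConjecture`, sub-problem `HodgeConjecture`, route `HCCMUnconditional`, crux `HD3`
(stmt-HodgeConjecture-24837; binder `hD3` = [Liu 2021, App. D Lem. D.1 (3)] AS PRINTED, per finite place, `n = 3`).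
PROVER FILE (cell `hodgecm-mathlib`; seat A-p15 as second of B-p19, director g2 batch 12): ONE theorem, sorry-free, no
definition, no named fact.

After line `a4-liuD3` v6 the crux `HD3` rests on IV-4(c3) ALONE: the line-rigidity residual `LineRigidityS6a` is the tree
theorem `HypD3.lineRigidityS6a` (B-p14 p606846 over B-p13's hypothesis-free S6a p606519) and IV-4(c1) is the tree theorem
`rankOne_theta_lines_disjoint_holds` (B-p10 p606332 over the cell's anisotropic-doubling programme).  Feeding both into
B-p19's head `hD3_of_lineRigidityS6a` (p606475) leaves

* `hD3_of_twistRigidity (hc3 : rankOne_theta_twist_rigidity) : HCCMUnconditional.HD3`.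

The closing file is then the one-liner `HD3_proof := hD3_of_twistRigidity ‹c3›` once IV-4(c3) has a tree name (route R:
`rankOne_theta_twist_rigidity_of_nonPeriodic₁₁` p606210 over the character-route programme for `NonPeriodic₁₁`).  HC_CM is
proved only modulo the 7 printed citations until rung 0 of the ladder closes; this file discharges none of them by itself.

## References
* [Liu2021] Y. Liu, *Fourier–Jacobi cycles and arithmetic relative trace formula*, Camb. J. Math. 9 (2021): App. D
  Lem. D.1 (3) (l. 5233), proof l. 5249–5255.
* [Kudla1994] S. Kudla, Israel J. Math. 87 (1994), §3 Thm. 3.1.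
* [MoeglinVignerasWaldspurger1987] LNM 1291, Chap. 3 IV.4.
-/

set_option autoImplicit false

noncomputable section

namespace Summit.HodgeConjecture.CorCM.HypD3

-- heartbeats: the spelled `LineRigidityS6a` binder type of `hD3_of_lineRigidityS6a` is large (its own declaration uses
-- `maxHeartbeats 1600000`); unifying it with `lineRigidityS6a` needs the same budget.
set_option maxHeartbeats 1600000 in
/-- **`HCCMUnconditional.HD3` from IV-4(c3) alone**: B-p19's head `hD3_of_lineRigidityS6a` with its line-rigidity binder
discharged by the tree theorem `HypD3.lineRigidityS6a` (S6a, hypothesis-free) and its IV-4(c1) binder by the tree theorem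
`rankOne_theta_lines_disjoint_holds`; the only remaining hypothesis is the named fact IV-4(c3)
`rankOne_theta_twist_rigidity` (twist rigidity of rank-one theta lifts at non-split places).
[cite: Liu2021, App. D Lem. D.1 (3) (l. 5233), proof l. 5249–5255] [cite: Kudla1994, §3 Thm. 3.1] -/
theorem hD3_of_twistRigidity
    (hc3 : Literature.RepresentationTheory.MoeglinVignerasWaldspurger1987.rankOne_theta_twist_rigidity) :
    Summit.HodgeConjecture.HodgeConjecture.Theses.HCCMUnconditional.HD3 :=
  hD3_of_lineRigidityS6a lineRigidityS6a
    Literature.RepresentationTheory.MoeglinVignerasWaldspurger1987.rankOne_theta_lines_disjoint_holds hc3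

end Summit.HodgeConjecture.CorCM.HypD3

end
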